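import Summits.Ventures.CertifiedArithmetic.LowPrec.SRFormatsBridge
import HarnessLib

/-!
# The textbook relative model `|δ| ≤ 2u` for SR: exactly where it holds and where it breaks

HONEST FRAMING: certified error envelopes and provably optimal rounding/accumulation schemes for
low-precision formats under stated cost models; every table by two implementations; no hardware or
vendor claims.

Connolly–Higham–Mary's analysis is written in the model `SR(x) = x(1+δ)`, `|δ| ≤ 2u` (their Lemma 4.5 /
(2.4)), valid "in the absence of underflow and overflow".  For a finite value set `F` this file makes the
range of validity exact:

* `gap_le_rel_of_cert` — from a **relative successor/predecessor certificate above a threshold `m`**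
  (every `a ∈ F` with `m ≤ a < max F` has a successor `≤ a + ρa`; mirror image below `−m`), every
  clamped argument with `|x̄| ≥ m` has candidate gap `≤ ρ|x̄|`, hence both SR outcomes satisfy
  `|SR(x̄) − x̄| ≤ ρ|x̄|` surely (`sure_rel_error_of_cert`): the `2u` model with `ρ = 2u = 2^{-M}`
  holds on the NORMAL range `|x̄| ≥ 2^{emin}`;
* kernel certificates for the five formats: E2M1 (`m = 1, ρ = 1/2`), E3M2 (`1/4, 1/4`), E2M3 (`1, 1/8`),
  E4M3 (`1/64, 1/8`), E5M2-finite (`2^{-14}, 1/4`);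
* **where it breaks** (kernel witnesses): below the smallest normal number the relative gap exceeds
  `ρ` and in the lowest subnormal cell the relative error of BOTH outcomes is `1` (E2M1 at `1/4`, E4M3 at
  `2^{-10}`) — the absolute (gap-based) statements of the other SR files are the ones that survive, with
  unchanged constants, through the subnormal range.
-/

namespace Summit.Ventures.CertifiedArithmetic.LowPrec.SR

open Literature.ComputerArithmetic.ConnollyHighamMary2021
open Literature.ComputerArithmetic.FloatingPoint
open Finset

variable {K : Type*} [Field K] [LinearOrder K] [IsStrictOrderedRing K]

/-- A **relative spacing certificate** for `F` above the threshold `m`: successors within the factor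
`1 + ρ` on `[m, max F)`, predecessors within `1 − ρ·|·|⁻¹…` i.e. `b ≥ a − ρ(−a)` on `(min F, −m]`, and
`±m ∈ F`. -/
structure RelCert (F : Finset K) (hF : F.Nonempty) (m ρ : K) : Prop where
  /-- the threshold is nonnegative -/
  m_nonneg : 0 ≤ m
  /-- the factor is nonnegative -/
  ρ_nonneg : 0 ≤ ρ
  /-- `m` is a format value -/
  mem : m ∈ F
  /-- `−m` is a format value -/
  neg_mem : -m ∈ F
  /-- successors above `m` -/
  succ : ∀ a ∈ F, m ≤ a → a < F.max' hF → ∃ b ∈ F, a < b ∧ b ≤ a + ρ * a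
  /-- predecessors below `−m` -/
  pred : ∀ a ∈ F, a ≤ -m → F.min' hF < a → ∃ b ∈ F, b < a ∧ a - ρ * (-a) ≤ b

/-- **Relative gap bound** on `{x̄ in the hull : |x̄| ≥ m}` from a relative spacing certificate. -/
theorem gap_le_rel_of_cert {F : Finset K} {hF : F.Nonempty} {m ρ : K} (hc : RelCert F hF m ρ)
    {x : K} (hx : InHull F x) (hmx : m ≤ |x|) :
    roundUp F x - roundDown F x ≤ ρ * |x| := by
  rcases le_or_gt 0 x with hx0 | hx0
  · -- positive side: work with d = roundDown x ≥ m
    rw [abs_of_nonneg hx0] at hmx ⊢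
    have hd : roundDown F x ∈ F := roundDown_mem hx.1
    have hmd : m ≤ roundDown F x := le_roundDown_of_mem hc.mem hmx
    by_cases hdm : roundDown F x < F.max' hF
    · obtain ⟨b, hb, hdb, hbr⟩ := hc.succ _ hd hmd hdm
      have hxb : x ≤ b := by
        by_contra hlt
        exact absurd (le_roundDown_of_mem hb (le_of_lt (lt_of_not_ge hlt))) (not_le.mpr hdb)
      have hub : roundUp F x ≤ b := roundUp_le_of_mem hb hxb
      have hdx : roundDown F x ≤ x := roundDown_le F x
      nlinarith [mul_le_mul_of_nonneg_left hdx hc.ρ_nonneg]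
    · have hmax : roundDown F x = F.max' hF := le_antisymm (F.le_max' _ hd) (not_lt.mp hdm)
      obtain ⟨z, hz, hxz⟩ := hx.2
      have hxle : x ≤ F.max' hF := hxz.trans (F.le_max' z hz)
      have hxeq : x = F.max' hF := le_antisymm hxle (hmax ▸ roundDown_le F x)
      have hxF : x ∈ F := hxeq ▸ F.max'_mem hF
      rw [roundUp_eq_self_of_mem hxF, roundDown_eq_self_of_mem hxF, sub_self]
      exact mul_nonneg hc.ρ_nonneg hx0
  · -- negative side: work with u = roundUp x ≤ -m
    rw [abs_of_neg hx0] at hmx ⊢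
    have hxm : x ≤ -m := by linarith
    have hu : roundUp F x ∈ F := roundUp_mem hx.2
    have hum : roundUp F x ≤ -m := roundUp_le_of_mem hc.neg_mem hxm
    by_cases hdm : F.min' hF < roundUp F x
    · obtain ⟨b, hb, hbu, hbr⟩ := hc.pred _ hu hum hdm
      have hbx : b ≤ x := by
        by_contra hlt
        exact absurd (roundUp_le_of_mem hb (le_of_lt (lt_of_not_ge hlt))) (not_le.mpr hbu)
      have hdb : b ≤ roundDown F x := le_roundDown_of_mem hb hbx
      have hxu : x ≤ roundUp F x := le_roundUp F x
      nlinarith [mul_le_mul_of_nonneg_left hxu hc.ρ_nonneg]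
    · have hmin : roundUp F x = F.min' hF := le_antisymm (not_lt.mp hdm) (F.min'_le _ hu)
      obtain ⟨z, hz, hzx⟩ := hx.1
      have hxge : F.min' hF ≤ x := (F.min'_le z hz).trans hzx
      have hxeq : x = F.min' hF := le_antisymm (hmin ▸ le_roundUp F x) hxge
      have hxF : x ∈ F := hxeq ▸ F.min'_mem hF
      rw [roundUp_eq_self_of_mem hxF, roundDown_eq_self_of_mem hxF, sub_self]
      exact mul_nonneg hc.ρ_nonneg (by linarith)

/-- **The `2u` model on the certified range, surely.** With a relative certificate `(m, ρ)`, every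
argument `c` whose clamped value has `|c̄| ≥ m` is rounded by saturating SR to one of two candidates
each within RELATIVE distance `ρ` of `c̄`: `|up − c̄| ≤ ρ|c̄|` and `|dn − c̄| ≤ ρ|c̄|`. -/
theorem sure_rel_error_of_cert {F : Finset K} {hF : F.Nonempty} {m ρ : K} (hc : RelCert F hF m ρ)
    (c : K) (hmc : m ≤ |clamp F c|) :
    |up F c - clamp F c| ≤ ρ * |clamp F c| ∧ |dn F c - clamp F c| ≤ ρ * |clamp F c| := by
  have hg := gap_le_rel_of_cert hc (clamp_inHull hF c) hmc
  exact ⟨(abs_roundUp_sub_le F _).trans hg, (abs_roundDown_sub_le F _).trans hg⟩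

/-! ### Kernel certificates for the five formats (`ρ = 2u = 2^{-M}`, `m` = smallest normal) -/

/-- E2M1 (`M = 1`, smallest normal `1`): relative certificate `(m, ρ) = (1, 1/2)`. -/
theorem FP4.e2m1_relCert : RelCert FP4.e2m1 FP4.e2m1_nonempty 1 (1 / 2) where
  m_nonneg := by norm_num
  ρ_nonneg := by norm_num
  mem := by decide +kernel
  neg_mem := by decide +kernel
  succ := by
    have hmax : FP4.e2m1.max' FP4.e2m1_nonempty = 6 := by decide +kernel
    rw [hmax]; decide +kernel
  pred := by
    have hmin : FP4.e2m1.min' FP4.e2m1_nonempty = -6 := by decide +kernel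
    rw [hmin]; decide +kernel

/-- E3M2 (`M = 2`, smallest normal `1/4`): relative certificate `(1/4, 1/4)`. -/
theorem Formats.e3m2_relCert : RelCert Formats.e3m2 Formats.e3m2_nonempty (1 / 4) (1 / 4) where
  m_nonneg := by norm_num
  ρ_nonneg := by norm_num
  mem := by decide +kernel
  neg_mem := by decide +kernel
  succ := by rw [Formats.e3m2_max]; decide +kernel
  pred := by
    have hmin : Formats.e3m2.min' Formats.e3m2_nonempty = -28 := by decide +kernel
    rw [hmin]; decide +kernel

/-- E2M3 (`M = 3`, smallest normal `1`): relative certificate `(1, 1/8)`. -/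
theorem Formats.e2m3_relCert : RelCert Formats.e2m3 Formats.e2m3_nonempty 1 (1 / 8) where
  m_nonneg := by norm_num
  ρ_nonneg := by norm_num
  mem := by decide +kernel
  neg_mem := by decide +kernel
  succ := by rw [Formats.e2m3_max]; decide +kernel
  pred := by
    have hmin : Formats.e2m3.min' Formats.e2m3_nonempty = -(15 / 2) := by decide +kernel
    rw [hmin]; decide +kernel

/-- E4M3 (`M = 3`, smallest normal `2^{-6}`): relative certificate `(1/64, 1/8)`. -/
theorem Formats.e4m3_relCert : RelCert Formats.e4m3 Formats.e4m3_nonempty (1 / 64) (1 / 8) where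
  m_nonneg := by norm_num
  ρ_nonneg := by norm_num
  mem := by decide +kernel
  neg_mem := by decide +kernel
  succ := by rw [Formats.e4m3_max]; decide +kernel
  pred := by
    have hmin : Formats.e4m3.min' Formats.e4m3_nonempty = -448 := by decide +kernel
    rw [hmin]; decide +kernel

/-- E5M2, finite part (`M = 2`, smallest normal `2^{-14}`): relative certificate `(2^{-14}, 1/4)`. -/
theorem Formats.e5m2_relCert :
    RelCert Formats.e5m2 Formats.e5m2_nonempty (1 / 16384) (1 / 4) where
  m_nonneg := by norm_num
  ρ_nonneg := by norm_num
  mem := by decide +kernel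
  neg_mem := by decide +kernel
  succ := by rw [Formats.e5m2_max]; decide +kernel
  pred := by
    have hmin : Formats.e5m2.min' Formats.e5m2_nonempty = -57344 := by decide +kernel
    rw [hmin]; decide +kernel

/-- **E4M3: the `2u = 1/8` model holds surely on the normal range** `|c̄| ≥ 2^{-6}` (incl. up to the
saturation value `448`): both SR outcomes are within relative distance `1/8` of `c̄`. -/
theorem Formats.e4m3_sure_rel_error (c : ℚ) (hmc : 1 / 64 ≤ |clamp Formats.e4m3 c|) :
    |up Formats.e4m3 c - clamp Formats.e4m3 c| ≤ 1 / 8 * |clamp Formats.e4m3 c| ∧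
    |dn Formats.e4m3 c - clamp Formats.e4m3 c| ≤ 1 / 8 * |clamp Formats.e4m3 c| :=
  sure_rel_error_of_cert Formats.e4m3_relCert c hmc

/-- The same over the substrate value set `MiniFloat.valueSet Format.E4M3`. -/
theorem valueSet_E4M3_sure_rel_error (c : ℚ)
    (hmc : 1 / 64 ≤ |clamp (MiniFloat.valueSet Format.E4M3) c|) :
    |up (MiniFloat.valueSet Format.E4M3) c - clamp (MiniFloat.valueSet Format.E4M3) c|
        ≤ 1 / 8 * |clamp (MiniFloat.valueSet Format.E4M3) c| ∧
    |dn (MiniFloat.valueSet Format.E4M3) c - clamp (MiniFloat.valueSet Format.E4M3) c|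
        ≤ 1 / 8 * |clamp (MiniFloat.valueSet Format.E4M3) c| := by
  rw [← e4m3_eq_valueSet] at hmc ⊢; exact Formats.e4m3_sure_rel_error c hmc

/-! ### Where the relative model breaks: the subnormal range (kernel witnesses) -/

/-- **E2M1 below the smallest normal:** at `c = 3/4` (between the subnormal `1/2` and the normal `1`)
the candidate gap `1/2` is `2/3` of `c`, exceeding `ρ·c = 3/8`; at `c = 1/4` (lowest cell) BOTH outcomes
`0` and `1/2` are at relative distance exactly `1` from `c`. -/
theorem FP4.e2m1_subnormal_witness :
    up FP4.e2m1 (3 / 4 : ℚ) - dn FP4.e2m1 (3 / 4) = 1 / 2 ∧ ¬ (1 / 2 : ℚ) ≤ 1 / 2 * |(3 / 4 : ℚ)| ∧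
    up FP4.e2m1 (1 / 4 : ℚ) = 1 / 2 ∧ dn FP4.e2m1 (1 / 4 : ℚ) = 0 ∧
    |up FP4.e2m1 (1 / 4 : ℚ) - 1 / 4| = 1 * |(1 / 4 : ℚ)| ∧
    |dn FP4.e2m1 (1 / 4 : ℚ) - 1 / 4| = 1 * |(1 / 4 : ℚ)| := by
  refine ⟨by decide +kernel, by norm_num, by decide +kernel, by decide +kernel, ?_, ?_⟩
  · have h : up FP4.e2m1 (1 / 4 : ℚ) = 1 / 2 := by decide +kernel
    rw [h]; norm_num
  · have h : dn FP4.e2m1 (1 / 4 : ℚ) = 0 := by decide +kernel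
    rw [h]; norm_num

/-- **E4M3 below the smallest normal `2^{-6}`:** at `c = 2^{-10}` (half the smallest subnormal `2^{-9}`)
the outcomes are `0` and `2^{-9}`, each at relative distance `1 > 2u = 1/8` from `c`; and at
`c = 3·2^{-9}/2` (between the subnormals `2^{-9}` and `2^{-8}`) the gap `2^{-9}` is `2/3` of `c`. -/
theorem Formats.e4m3_subnormal_witness :
    up Formats.e4m3 (1 / 1024 : ℚ) = 1 / 512 ∧ dn Formats.e4m3 (1 / 1024 : ℚ) = 0 ∧
    |up Formats.e4m3 (1 / 1024 : ℚ) - 1 / 1024| = 1 * |(1 / 1024 : ℚ)| ∧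
    |dn Formats.e4m3 (1 / 1024 : ℚ) - 1 / 1024| = 1 * |(1 / 1024 : ℚ)| ∧
    up Formats.e4m3 (3 / 1024 : ℚ) - dn Formats.e4m3 (3 / 1024) = 1 / 512 ∧
    ¬ (1 / 512 : ℚ) ≤ 1 / 8 * |(3 / 1024 : ℚ)| := by
  have hu : up Formats.e4m3 (1 / 1024 : ℚ) = 1 / 512 := by decide +kernel
  have hd : dn Formats.e4m3 (1 / 1024 : ℚ) = 0 := by decide +kernel
  refine ⟨hu, hd, ?_, ?_, by decide +kernel, by norm_num⟩
  · rw [hu]; norm_num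
  · rw [hd]; norm_num

end Summit.Ventures.CertifiedArithmetic.LowPrec.SR
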